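import Literature.AlgebraicGeometry.ModuliOfAbelianVarieties.SiegelUniversalFamilyUniformisation   -- ★ P-3 tokens
import Literature.AlgebraicGeometry.ModuliOfAbelianVarieties.SiegelAdmissibleMarkingUniqueTorus     -- ★ `SiegelAdelicMarking.toFun_eq_toFun_of_lifts`
import Literature.AlgebraicGeometry.ModuliOfAbelianVarieties.SiegelShimuraSetPrincipalDissection    -- ★ `exists_principalRep`
import Literature.AlgebraicGeometry.AbelianSchemes.AbelianSchemeFibreHom                           -- ★ `fibrePointToLeft_injective`
import Literature.Geometry.ComplexAnalytic.RelativeExponentialChartGlue                            -- ★ `IsRelExpChartOn.exists_chart_of_local_of_rigid'`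
import HarnessLib

/-!
# The tautological charts of the pulled-back universal family GLUE: P-3's chart over the whole lift open `U` from charts near each point
# ([Milne2005ShimuraVarieties] §6 Thm. 6.11 (rigidity: lemma of Serre); [BirkenhakeLange2004] §8.7; [Lange2023AbelianVarietiesComplex] §3.4 Prop. 3.4.1)

Layer `Literature/AlgebraicGeometry/ModuliOfAbelianVarieties`, namespace `Literature.AlgebraicGeometry.ModuliOfAbelianVarieties`.  THEOREMS ONLY
(no definition, no named fact, no instance, no notation, no `sorry`).  Cell `hodgecm-mathlib` (D-0151), FLOOR 0, P6 «MOD» (crux hLiu418 =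
stmt-HodgeConjecture-24832, `--supports`), half A line L7, socket `stub_UNIVFAM` = ★ P-3 `siegelUniversalFamilyUniformisation` (E-LINE
`Cruxes/HLiu418/Lines/F0_P6a_PELWitnessE.lean` :654), organ **O6 «GLUE»** of `StubUNIVFAM.closer.skeleton.v1` (LA7-plan deal v1 2026-09-02T02:05Z,
dealt to LA7-p02): «(∀ `t₀ ∈ U`, ∃ open `V ∋ t₀`, `V ⊆ U`, ∃ `Φ ex`, the FOUR P-3 conjuncts on `V`) ⊢ the four P-3 conjuncts on `U`».
HC_CM is proved only modulo the printed citations until rung 0 closes; this file is count-neutral.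

THE MATHEMATICS.  P-3's conclusion for the pulled-back triple `P = P_T` over an open `U` of `T^an` is a relative exponential chart `(Φ, ex)`
whose FIBRE DATUM at every `t ∈ U` is in NORMAL FORM: `Φ t = Π_{s t}` (tautological periods), (G) the fibre map `ex (t, ·)` descends to an
additive analytification of the algebraic fibre `A_t`, (ADM) for every principal representative `r` of the component `c` it IS the torus map
of an admissible marking `m` of `A_t` by `[J(s t), r]` with `m.γ = 1`, `m.Ψ = Π_{s t}`.  THIS NORMAL FORM IS RIGID (`fibreDatum_rigid`): the
period isomorphism is pinned by `Π_{s t}`, and two admissible markings of one fibre at the same `(Z, r)` with the same frame `γ` have the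
same torus map — [Milne2005ShimuraVarieties] Thm. 6.11 with the lemma of Serre (`N ≥ 3`), in the tree ★ `SiegelAdelicMarking.toFun_eq_toFun_of_lifts`
— so the fibre maps agree in `A(ℂ)` (★ `fibrePointToLeft_injective`), hence in `MA` (the analytification `φA` is injective); principal
representatives exist for every `c` (★ `exists_principalRep`).  Therefore the local charts near the points of `U` all agree with the
pointwise choice and glue (★ generic `IsRelExpChartOn.exists_chart_of_local_of_rigid'`): `chart_of_local`.  This is how the universal marked
family over an evenly covered open is assembled from local markings in print ([BirkenhakeLange2004] §8.7; [Lange2023AbelianVarietiesComplex] §3.4).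

* `fibreDatum_rigid` — rigidity of the P-3 normal form at a point `t ∈ U`;
* `chart_of_local` — THE O6 HEAD: local P-3 charts near every point of `U` ⟹ the P-3 chart over `U` (binders: P-3's `g N δ hg hδ hN 𝓜 c Sc ιc T d
  ψ MT φT hT MA φA hA U s hs`; the (U2+)∕(U3) clauses of the piece and the lift equation are not needed for gluing and are not bound).

## References
* [Milne2005ShimuraVarieties] J. S. Milne, *Introduction to Shimura Varieties* (2005), §6 Thm. 6.11 p. 74 (moduli interpretation; rigidity by the
  lemma of Serre for `N ≥ 3`).
* [BirkenhakeLange2004] C. Birkenhake, H. Lange, *Complex Abelian Varieties*, 2nd ed. (2004), Ch. 8 §8.7 (the universal family over `𝔥_g`).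
* [Lange2023AbelianVarietiesComplex] H. Lange, *Abelian Varieties over the Complex Numbers* (2023), §3.4 Prop. 3.4.1 p. 186.
-/

set_option autoImplicit false

noncomputable section

open CategoryTheory CategoryTheory.Limits AlgebraicGeometry Matrix Topology Set
open scoped Manifold ContDiff Matrix.Norms.Elementwise
open Literature.AlgebraicGeometry.Motives (SchemeOver ComplexPoints AlgPoints specOver AbelianVariety CartierDivisor)
open Literature.AlgebraicGeometry.AbelianSchemes (PolarizedAbelianSchemeWithLevel AbelianSchemeOver)
open Literature.Geometry.Kaehler (ComplexTorus)
open Literature.Geometry.Kaehler.ComplexTorus (cover)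
open Literature.Geometry.ComplexAnalytic (IsRelExpChartOn totalOver basePoint)
open Literature.NumberTheory.Transcendental (IsAnalytification)
open Literature.NumberTheory.Automorphic (siegelUpperHalfSpace)
open Literature.NumberTheory.Adeles (latticeOfGL)

namespace Literature.AlgebraicGeometry.ModuliOfAbelianVarieties

open SiegelModuli (jOfSiegel)

namespace SiegelUniversalFamilyChartGluing

variable {g N : ℕ} {δ : Fin g → ℕ}

/-! ### §1 Rigidity of the P-3 fibre normal form -/

/-- **THE P-3 FIBRE NORMAL FORM IS RIGID** ([Milne2005ShimuraVarieties] Thm. 6.11 with the lemma of Serre, `N ≥ 3`): at a complex point `x` of the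
base with period point `Z ∈ 𝔥_g`, let `(Φ₁, f₁)`, `(Φ₂, f₂)` be two fibre data (period isomorphism, fibre map `ℂ^g → MA`) each of which has
`Φᵢ = Π_Z` and is, for EVERY principal representative `r` of `c`, the torus map of an admissible marking `mᵢ` of the fibre `B_x` by `[J(Z), r]`
with `mᵢ.γ = 1`, `mᵢ.Ψ = Π_Z`, read in the total space through the injective `φA`.  Then `Φ₁ = Φ₂` and `f₁ = f₂`: principal representatives exist
(★ `exists_principalRep`), the two markings have the same torus map (★ `SiegelAdelicMarking.toFun_eq_toFun_of_lifts`), points of a fibre are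
determined in the total space (★ `fibrePointToLeft_injective`), and `φA` is injective.
[cite: Milne2005ShimuraVarieties, §6 Thm. 6.11 p. 74] [cite: BirkenhakeLange2004, §8.7] -/
theorem fibreDatum_rigid (hg : 0 < g) (hδ : IsPolarizationType δ) (hN : 3 ≤ N) (c : (ZMod N)ˣ)
    {S : Scheme} (B : AbelianSchemeOver S) (D : B.DualPair) (lam : B.X ⟶ D.hat.X) (lvl : B.LevelStructure g N)
    (x : Spec (CommRingCat.of ℂ) ⟶ S) {Z : Matrix (Fin g) (Fin g) ℂ} (hZ : Z ∈ siegelUpperHalfSpace g)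
    {MA : Type*} {Y : Type*} (φA : MA → Y) (hφA : Function.Injective φA) (left : Y → (Spec (CommRingCat.of ℂ) ⟶ B.X.left))
    (hleft : Function.Injective left)
    {Φ₁ Φ₂ : (Fin g ⊕ Fin g → ℝ) ≃L[ℝ] (Fin g → ℂ)} {f₁ f₂ : (Fin g → ℂ) → MA}
    (hΦ₁ : ∀ v, Φ₁ v = siegelPeriodMap δ Z v) (hΦ₂ : ∀ v, Φ₂ v = siegelPeriodMap δ Z v)
    (h₁ : ∀ (u : finAdeleQˣ) (r : gspFinAdelic δ),
      (∀ v, Valued.v ((u : finAdeleQ) v) = 1) →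
      (u : finAdeleQ) - ((c : ZMod N).val : ℕ) ∈ levelIdeal N →
      r ∈ principalLevelSubgroup δ 1 →
      IsMultiplier (typeFormOver δ finAdeleQ) (r : GL (Fin g ⊕ Fin g) finAdeleQ) u →
      ((r : GL (Fin g ⊕ Fin g) finAdeleQ) : Matrix (Fin g ⊕ Fin g) (Fin g ⊕ Fin g) finAdeleQ) =
        Matrix.fromBlocks 1 0 0 ((u : finAdeleQ) • (1 : Matrix (Fin g) (Fin g) finAdeleQ)) →
        ∃ (m : SiegelAdelicMarking ⟨jOfSiegel δ Z, SiegelComplexRecordSystem.jOfSiegel_mem_C0pm hδ.1 hZ⟩ r (B.fibre x).toAbelianVariety)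
          (Θ : CartierDivisor (B.fibre x).toAbelianVariety.X.left) (Λ : lvl.SymplecticLift x Θ δ),
          Θ.IsAmple ∧ B.IsLambdaOfAt x D lam Θ ∧
          (∀ ⦃M : ℕ⦄, N ∣ M → M ≠ 0 → ∀ (y : Fin g ⊕ Fin g → ZMod M) (v : Fin g ⊕ Fin g → ℚ),
            AdelicCongr ((r⁻¹ : gspFinAdelic δ) : GL (Fin g ⊕ Fin g) finAdeleQ) 1 v (fun i => ((y i).val : ℚ) / M) →
              ((Λ.lift M (Multiplicative.ofAdd y)) : (B.fibre x).toAbelianVariety.Points ℂ) = m.r v) ∧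
          m.γ = 1 ∧ (∀ v : Fin g ⊕ Fin g → ℝ, m.Ψ v = siegelPeriodMap δ Z v) ∧
          ∀ z : Fin g → ℂ, B.fibrePointToLeft x (m.toFun (cover m.Ψ z)) = left (φA (f₁ z)))
    (h₂ : ∀ (u : finAdeleQˣ) (r : gspFinAdelic δ),
      (∀ v, Valued.v ((u : finAdeleQ) v) = 1) →
      (u : finAdeleQ) - ((c : ZMod N).val : ℕ) ∈ levelIdeal N →
      r ∈ principalLevelSubgroup δ 1 →
      IsMultiplier (typeFormOver δ finAdeleQ) (r : GL (Fin g ⊕ Fin g) finAdeleQ) u →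
      ((r : GL (Fin g ⊕ Fin g) finAdeleQ) : Matrix (Fin g ⊕ Fin g) (Fin g ⊕ Fin g) finAdeleQ) =
        Matrix.fromBlocks 1 0 0 ((u : finAdeleQ) • (1 : Matrix (Fin g) (Fin g) finAdeleQ)) →
        ∃ (m : SiegelAdelicMarking ⟨jOfSiegel δ Z, SiegelComplexRecordSystem.jOfSiegel_mem_C0pm hδ.1 hZ⟩ r (B.fibre x).toAbelianVariety)
          (Θ : CartierDivisor (B.fibre x).toAbelianVariety.X.left) (Λ : lvl.SymplecticLift x Θ δ),
          Θ.IsAmple ∧ B.IsLambdaOfAt x D lam Θ ∧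
          (∀ ⦃M : ℕ⦄, N ∣ M → M ≠ 0 → ∀ (y : Fin g ⊕ Fin g → ZMod M) (v : Fin g ⊕ Fin g → ℚ),
            AdelicCongr ((r⁻¹ : gspFinAdelic δ) : GL (Fin g ⊕ Fin g) finAdeleQ) 1 v (fun i => ((y i).val : ℚ) / M) →
              ((Λ.lift M (Multiplicative.ofAdd y)) : (B.fibre x).toAbelianVariety.Points ℂ) = m.r v) ∧
          m.γ = 1 ∧ (∀ v : Fin g ⊕ Fin g → ℝ, m.Ψ v = siegelPeriodMap δ Z v) ∧
          ∀ z : Fin g → ℂ, B.fibrePointToLeft x (m.toFun (cover m.Ψ z)) = left (φA (f₂ z))) :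
    Φ₁ = Φ₂ ∧ f₁ = f₂ := by
  refine ⟨ContinuousLinearEquiv.ext (funext fun v => (hΦ₁ v).trans (hΦ₂ v).symm), funext fun z => ?_⟩
  -- a principal representative of `c`
  have hN0 : N ≠ 0 := by omega
  obtain ⟨u, r, hu, huc, hr, hmult, hmat⟩ := exists_principalRep δ hN0 c
  obtain ⟨m₁, Θ₁, Λ₁, -, hΘl₁, hΛ₁, hγ₁, hΨ₁, hf₁⟩ := h₁ u r hu huc hr hmult hmat
  obtain ⟨m₂, Θ₂, Λ₂, -, hΘl₂, hΛ₂, hγ₂, hΨ₂, hf₂⟩ := h₂ u r hu huc hr hmult hmat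
  -- the two markings have the same torus map (Milne Thm. 6.11 / lemma of Serre) and the same `Ψ`
  have hΨ : m₁.Ψ = m₂.Ψ := ContinuousLinearEquiv.ext (funext fun v => (hΨ₁ v).trans (hΨ₂ v).symm)
  have htorus : m₁.toFun (cover m₁.Ψ z) = m₂.toFun (cover m₂.Ψ z) := by
    have h := SiegelAdelicMarking.toFun_eq_toFun_of_lifts hg hδ hN hr hZ m₁ Λ₁ hΘl₁ hΛ₁ m₂ Λ₂ hΘl₂ hΛ₂ (hγ₁.trans hγ₂.symm)
      (cover m₁.Ψ z)
    rw [h]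
    exact congrArg m₂.toFun (by rw [hΨ])
  apply hφA
  apply hleft
  rw [← hf₁ z, ← hf₂ z, htorus]

/-! ### §2 THE O6 HEAD: local P-3 charts glue to the P-3 chart over `U` -/

/-- **O6 «GLUE» — THE TAUTOLOGICAL CHARTS OF THE PULLED-BACK UNIVERSAL FAMILY GLUE OVER THE LIFT'S OPEN `U`** (P-3 ★
`siegelUniversalFamilyUniformisation` is local on `U`): with P-3's data — `𝓜`, the piece inclusion `ιc : Sc → 𝓜 ⊗ ℂ` and its index `c`, a smooth
`T` with `ψ : T ⟶ Sc`, analytifications `φT`, `φA` of `T` and of the total space of `P := 𝓜.univ.baseChange (ψ ≫ ιc ≫ pr)`, an open `U ⊆ MT` and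
`s : MT → M_g(ℂ)` with `s t ∈ 𝔥_g` on `U` — IF every `t₀ ∈ U` has an open `V ∋ t₀`, `V ⊆ U`, and a pair `(Φ, ex)` satisfying the FOUR conjuncts
of P-3's conclusion on `V` (tautological periods, (C) chart, (G) additive fibre analytifications, (ADM) admissible markings with `γ = 1`,
`Ψ = Π_{s t}`, torus map = fibre map), THEN there is ONE pair `(Φ, ex)` satisfying the four conjuncts on `U`.  Rigidity `fibreDatum_rigid` + ★
`IsRelExpChartOn.exists_chart_of_local_of_rigid'`; the default fibre map off `U` is the zero section read through `φA⁻¹`.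
[cite: Milne2005ShimuraVarieties, §6 Thm. 6.11 p. 74] [cite: BirkenhakeLange2004, §8.7] [cite: Lange2023AbelianVarietiesComplex, §3.4 Prop. 3.4.1 p. 186] -/
theorem chart_of_local (g N : ℕ) (δ : Fin g → ℕ) (hg : 0 < g) (hδ : IsPolarizationType δ) (hN : 3 ≤ N)
    (𝓜 : SiegelFineModuliScheme g N δ) (c : (ZMod N)ˣ) (Sc : SchemeOver ℂ) (ιc : Sc ⟶ (Motives.baseChange ℚ ℂ).obj 𝓜.M)
    (T : SchemeOver ℂ) (d : ℕ) (ψ : T ⟶ Sc)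
    (MT : Type) [TopologicalSpace MT] [ChartedSpace (Fin d → ℂ) MT]
    (φT : MT → ComplexPoints T) (hT : IsAnalytification (Fin d → ℂ) T d φT)
    (MA : Type) [TopologicalSpace MA] [ChartedSpace (Fin (d + g) → ℂ) MA]
    (φA : MA → ComplexPoints (totalOver T
      (𝓜.univ.baseChange (ψ.left ≫ ιc.left ≫ pullback.fst 𝓜.M.hom (Spec.map (CommRingCat.ofHom (algebraMap ℚ ℂ))))).A))
    (hA : IsAnalytification (Fin (d + g) → ℂ) (totalOver T
      (𝓜.univ.baseChange (ψ.left ≫ ιc.left ≫ pullback.fst 𝓜.M.hom (Spec.map (CommRingCat.ofHom (algebraMap ℚ ℂ))))).A) (d + g) φA)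
    (U : Set MT) (s : MT → Matrix (Fin g) (Fin g) ℂ) (hs : ∀ t ∈ U, s t ∈ siegelUpperHalfSpace g)
    (hloc : letI P := 𝓜.univ.baseChange (ψ.left ≫ ιc.left ≫ pullback.fst 𝓜.M.hom (Spec.map (CommRingCat.ofHom (algebraMap ℚ ℂ))))
      ∀ t₀ ∈ U, ∃ (V : Set MT) (_ : IsOpen V) (_ : t₀ ∈ V) (hVU : V ⊆ U)
        (Φ : MT → ((Fin g ⊕ Fin g → ℝ) ≃L[ℝ] (Fin g → ℂ))) (ex : MT × (Fin g → ℂ) → MA),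
        (∀ t ∈ V, ∀ v : Fin g ⊕ Fin g → ℝ, Φ t v = siegelPeriodMap δ (s t) v) ∧
        IsRelExpChartOn (Fin d → ℂ) (Fin (d + g) → ℂ) (basePoint hT P.A φA) V Φ ex ∧
        (∀ t ∈ V, ∃ φt : ComplexTorus (Φ t) → (P.A.fibre (φT t).left).toAbelianVariety.Points ℂ,
          IsAnalytification (Fin g → ℂ) (P.A.fibre (φT t).left).toAbelianVariety.X g φt ∧
          (∀ x y, φt (x + y) = φt x * φt y) ∧
          ∀ z : Fin g → ℂ, (φA (ex (t, z))).left = P.A.fibrePointToLeft (φT t).left (φt (cover (Φ t) z))) ∧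
        (∀ (u : finAdeleQˣ) (r : gspFinAdelic δ),
          (∀ v, Valued.v ((u : finAdeleQ) v) = 1) →
          (u : finAdeleQ) - ((c : ZMod N).val : ℕ) ∈ levelIdeal N →
          r ∈ principalLevelSubgroup δ 1 →
          IsMultiplier (typeFormOver δ finAdeleQ) (r : GL (Fin g ⊕ Fin g) finAdeleQ) u →
          ((r : GL (Fin g ⊕ Fin g) finAdeleQ) : Matrix (Fin g ⊕ Fin g) (Fin g ⊕ Fin g) finAdeleQ) =
            Matrix.fromBlocks 1 0 0 ((u : finAdeleQ) • (1 : Matrix (Fin g) (Fin g) finAdeleQ)) →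
          ∀ (t : MT) (ht : t ∈ V),
            ∃ (m : SiegelAdelicMarking ⟨jOfSiegel δ (s t), SiegelComplexRecordSystem.jOfSiegel_mem_C0pm hδ.1 (hs t (hVU ht))⟩ r
                  (P.A.fibre (φT t).left).toAbelianVariety)
              (Θ : CartierDivisor (P.A.fibre (φT t).left).toAbelianVariety.X.left)
              (Λ : P.level.SymplecticLift (φT t).left Θ δ),
              Θ.IsAmple ∧ P.A.IsLambdaOfAt (φT t).left P.D P.pol.lam Θ ∧
              (∀ ⦃M : ℕ⦄, N ∣ M → M ≠ 0 → ∀ (x : Fin g ⊕ Fin g → ZMod M) (v : Fin g ⊕ Fin g → ℚ),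
                AdelicCongr ((r⁻¹ : gspFinAdelic δ) : GL (Fin g ⊕ Fin g) finAdeleQ) 1 v (fun i => ((x i).val : ℚ) / M) →
                  ((Λ.lift M (Multiplicative.ofAdd x)) : (P.A.fibre (φT t).left).toAbelianVariety.Points ℂ) = m.r v) ∧
              m.γ = 1 ∧ (∀ v : Fin g ⊕ Fin g → ℝ, m.Ψ v = siegelPeriodMap δ (s t) v) ∧
              ∀ z : Fin g → ℂ, P.A.fibrePointToLeft (φT t).left (m.toFun (cover m.Ψ z)) = (φA (ex (t, z))).left)) :
    letI P := 𝓜.univ.baseChange (ψ.left ≫ ιc.left ≫ pullback.fst 𝓜.M.hom (Spec.map (CommRingCat.ofHom (algebraMap ℚ ℂ))))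
    ∃ (Φ : MT → ((Fin g ⊕ Fin g → ℝ) ≃L[ℝ] (Fin g → ℂ))) (ex : MT × (Fin g → ℂ) → MA),
      (∀ t ∈ U, ∀ v : Fin g ⊕ Fin g → ℝ, Φ t v = siegelPeriodMap δ (s t) v) ∧
      IsRelExpChartOn (Fin d → ℂ) (Fin (d + g) → ℂ) (basePoint hT P.A φA) U Φ ex ∧
      (∀ t ∈ U, ∃ φt : ComplexTorus (Φ t) → (P.A.fibre (φT t).left).toAbelianVariety.Points ℂ,
        IsAnalytification (Fin g → ℂ) (P.A.fibre (φT t).left).toAbelianVariety.X g φt ∧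
        (∀ x y, φt (x + y) = φt x * φt y) ∧
        ∀ z : Fin g → ℂ, (φA (ex (t, z))).left = P.A.fibrePointToLeft (φT t).left (φt (cover (Φ t) z))) ∧
      (∀ (u : finAdeleQˣ) (r : gspFinAdelic δ),
        (∀ v, Valued.v ((u : finAdeleQ) v) = 1) →
        (u : finAdeleQ) - ((c : ZMod N).val : ℕ) ∈ levelIdeal N →
        r ∈ principalLevelSubgroup δ 1 →
        IsMultiplier (typeFormOver δ finAdeleQ) (r : GL (Fin g ⊕ Fin g) finAdeleQ) u →
        ((r : GL (Fin g ⊕ Fin g) finAdeleQ) : Matrix (Fin g ⊕ Fin g) (Fin g ⊕ Fin g) finAdeleQ) =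
          Matrix.fromBlocks 1 0 0 ((u : finAdeleQ) • (1 : Matrix (Fin g) (Fin g) finAdeleQ)) →
        ∀ (t : MT) (ht : t ∈ U),
          ∃ (m : SiegelAdelicMarking ⟨jOfSiegel δ (s t), SiegelComplexRecordSystem.jOfSiegel_mem_C0pm hδ.1 (hs t ht)⟩ r
                (P.A.fibre (φT t).left).toAbelianVariety)
            (Θ : CartierDivisor (P.A.fibre (φT t).left).toAbelianVariety.X.left)
            (Λ : P.level.SymplecticLift (φT t).left Θ δ),
            Θ.IsAmple ∧ P.A.IsLambdaOfAt (φT t).left P.D P.pol.lam Θ ∧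
            (∀ ⦃M : ℕ⦄, N ∣ M → M ≠ 0 → ∀ (x : Fin g ⊕ Fin g → ZMod M) (v : Fin g ⊕ Fin g → ℚ),
              AdelicCongr ((r⁻¹ : gspFinAdelic δ) : GL (Fin g ⊕ Fin g) finAdeleQ) 1 v (fun i => ((x i).val : ℚ) / M) →
                ((Λ.lift M (Multiplicative.ofAdd x)) : (P.A.fibre (φT t).left).toAbelianVariety.Points ℂ) = m.r v) ∧
            m.γ = 1 ∧ (∀ v : Fin g ⊕ Fin g → ℝ, m.Ψ v = siegelPeriodMap δ (s t) v) ∧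
            ∀ z : Fin g → ℂ, P.A.fibrePointToLeft (φT t).left (m.toFun (cover m.Ψ z)) = (φA (ex (t, z))).left) := by
  let P := 𝓜.univ.baseChange (ψ.left ≫ ιc.left ≫ pullback.fst 𝓜.M.hom (Spec.map (CommRingCat.ofHom (algebraMap ℚ ℂ))))
  classical
  -- the pointwise NORMAL FORM `Q t Φ_t f` of a fibre datum at `t` (period isomorphism `Φ_t`, fibre map `f : ℂ^g → MA`)
  let Q : MT → ((Fin g ⊕ Fin g → ℝ) ≃L[ℝ] (Fin g → ℂ)) → ((Fin g → ℂ) → MA) → Prop := fun t Φt f =>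
    ∀ ht : t ∈ U,
      (∀ v : Fin g ⊕ Fin g → ℝ, Φt v = siegelPeriodMap δ (s t) v) ∧
      (∃ φt : ComplexTorus Φt → (P.A.fibre (φT t).left).toAbelianVariety.Points ℂ,
        IsAnalytification (Fin g → ℂ) (P.A.fibre (φT t).left).toAbelianVariety.X g φt ∧
        (∀ x y, φt (x + y) = φt x * φt y) ∧
        ∀ z : Fin g → ℂ, (φA (f z)).left = P.A.fibrePointToLeft (φT t).left (φt (cover Φt z))) ∧
      ∀ (u : finAdeleQˣ) (r : gspFinAdelic δ),
        (∀ v, Valued.v ((u : finAdeleQ) v) = 1) →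
        (u : finAdeleQ) - ((c : ZMod N).val : ℕ) ∈ levelIdeal N →
        r ∈ principalLevelSubgroup δ 1 →
        IsMultiplier (typeFormOver δ finAdeleQ) (r : GL (Fin g ⊕ Fin g) finAdeleQ) u →
        ((r : GL (Fin g ⊕ Fin g) finAdeleQ) : Matrix (Fin g ⊕ Fin g) (Fin g ⊕ Fin g) finAdeleQ) =
          Matrix.fromBlocks 1 0 0 ((u : finAdeleQ) • (1 : Matrix (Fin g) (Fin g) finAdeleQ)) →
          ∃ (m : SiegelAdelicMarking ⟨jOfSiegel δ (s t), SiegelComplexRecordSystem.jOfSiegel_mem_C0pm hδ.1 (hs t ht)⟩ r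
                (P.A.fibre (φT t).left).toAbelianVariety)
            (Θ : CartierDivisor (P.A.fibre (φT t).left).toAbelianVariety.X.left)
            (Λ : P.level.SymplecticLift (φT t).left Θ δ),
            Θ.IsAmple ∧ P.A.IsLambdaOfAt (φT t).left P.D P.pol.lam Θ ∧
            (∀ ⦃M : ℕ⦄, N ∣ M → M ≠ 0 → ∀ (x : Fin g ⊕ Fin g → ZMod M) (v : Fin g ⊕ Fin g → ℚ),
              AdelicCongr ((r⁻¹ : gspFinAdelic δ) : GL (Fin g ⊕ Fin g) finAdeleQ) 1 v (fun i => ((x i).val : ℚ) / M) →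
                ((Λ.lift M (Multiplicative.ofAdd x)) : (P.A.fibre (φT t).left).toAbelianVariety.Points ℂ) = m.r v) ∧
            m.γ = 1 ∧ (∀ v : Fin g ⊕ Fin g → ℝ, m.Ψ v = siegelPeriodMap δ (s t) v) ∧
            ∀ z : Fin g → ℂ, P.A.fibrePointToLeft (φT t).left (m.toFun (cover m.Ψ z)) = (φA (f z)).left
  -- RIGIDITY of the normal form
  have hrigid : ∀ t ∈ U, ∀ (Φ₁ Φ₂ : (Fin g ⊕ Fin g → ℝ) ≃L[ℝ] (Fin g → ℂ)) (f₁ f₂ : (Fin g → ℂ) → MA),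
      Q t Φ₁ f₁ → Q t Φ₂ f₂ → Φ₁ = Φ₂ ∧ f₁ = f₂ := by
    intro t ht Φ₁ Φ₂ f₁ f₂ hQ₁ hQ₂
    obtain ⟨hΦ₁, -, hA₁⟩ := hQ₁ ht
    obtain ⟨hΦ₂, -, hA₂⟩ := hQ₂ ht
    exact fibreDatum_rigid hg hδ hN c P.A P.D P.pol.lam P.level (φT t).left (hs t ht) φA hA.isHomeomorph.injective
      (fun y : ComplexPoints (totalOver T P.A) => y.left) (fun y₁ y₂ h => Over.OverMorphism.ext h) hΦ₁ hΦ₂ hA₁ hA₂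
  -- LOCAL EXISTENCE in `Q`-form
  have hloc' : ∀ t₀ ∈ U, ∃ V : Set MT, IsOpen V ∧ t₀ ∈ V ∧ V ⊆ U ∧
      ∃ (Φ' : MT → ((Fin g ⊕ Fin g → ℝ) ≃L[ℝ] (Fin g → ℂ))) (ex' : MT × (Fin g → ℂ) → MA),
        IsRelExpChartOn (Fin d → ℂ) (Fin (d + g) → ℂ) (basePoint hT P.A φA) V Φ' ex' ∧
        ∀ t ∈ V, Q t (Φ' t) (fun z => ex' (t, z)) := by
    intro t₀ ht₀
    obtain ⟨V, hVo, ht₀V, hVU, Φ', ex', h1, h2, h3, h4⟩ := hloc t₀ ht₀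
    exact ⟨V, hVo, ht₀V, hVU, Φ', ex', h2, fun t htV _ => ⟨h1 t htV, h3 t htV,
      fun u r hu huc hr hmult hmat => h4 u r hu huc hr hmult hmat t htV⟩⟩
  -- DEFAULTS off `U`: the principal period isomorphism and the zero section read through `φA⁻¹`
  have hpt : ∀ t : MT, ∃ a : MA, (φA a).left = P.A.fibrePointToLeft (φT t).left 1 := by
    intro t
    have w : P.A.fibrePointToLeft (φT t).left 1 ≫ (totalOver T P.A).hom = (specOver ℂ ℂ).hom := by
      change P.A.fibrePointToLeft (φT t).left 1 ≫ P.A.X.hom ≫ T.hom = _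
      rw [← Category.assoc, AbelianSchemeOver.fibrePointToLeft_comp_hom]
      exact Over.w (φT t)
    obtain ⟨a, ha⟩ := hA.isHomeomorph.surjective (Over.homMk (P.A.fibrePointToLeft (φT t).left 1) w)
    exact ⟨a, by rw [ha]; rfl⟩
  choose dflt hdflt using hpt
  obtain ⟨Φ, ex, hchart, hQ⟩ := IsRelExpChartOn.exists_chart_of_local_of_rigid' hrigid hloc'
    (fun _ => siegelPeriodEquiv hδ.1 (I_smul_one_mem_siegelUpperHalfSpace g)) (fun q => dflt q.1)
  refine ⟨Φ, ex, fun t ht => (hQ t ht ht).1, hchart, fun t ht => (hQ t ht ht).2.1,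
    fun u r hu huc hr hmult hmat t ht => (hQ t ht ht).2.2 u r hu huc hr hmult hmat⟩

end SiegelUniversalFamilyChartGluing

end Literature.AlgebraicGeometry.ModuliOfAbelianVarieties

end
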